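import Mathlib
import Literature.MathematicalPhysics.QuantumFieldTheory.Balaban1983to89.B14Sect3Decomp

/-!
# `Balaban1983to89.B14Claim310TwoStage` — T. Bałaban, *Convergent renormalization expansions for lattice gauge theories*,
# Commun. Math. Phys. **119** (1988) 243–285 [Balaban1988Convergent]: the sentence after (3.10) p. 266, *"This minimum is
# given by V^{(k)} = M^k(U_{k+1})"* (`B14.Sect3Decomp.Claim310`), PROVED by two-stage constrained minimization

statement-level skeleton of published theorems with citation tags; proofs where landed; nothing here is a claim about the Yang–Mills mass gap

PDF held: `paper:balaban1988-cmp119-convergent-renormalization` (journal page = PDF page + 242); p. 266 read on the x2 render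
`…-p024-x2.png` of `run/shared/lean/pub/pub-balaban/b2b-balaban-ref1/pages/1988-cmp119-convergent-renormalization/`.

CITATION HEADER (lean-in-tree rule).  WHAT IS REPRODUCED, verbatim, p. 266 [PDF 24]: *"Define the field V^{(k)} on Ω^{(k)}_{k+1}
as the minimum of the functional V_k|_{Ω^{(k)}_{k+1}} → A(U_k) for V_k : V̄_k = V_{k+1} on Γ_{k+1} = Ω^{(k+1)}_{k+1}, V_k(y, x) = 1
for y ∈ Γ_{k+1}, x ∈ B(y). (3.10)  This minimum is given by V^{(k)} = M^k(U_{k+1}), where the minimal configuration U_{k+1} is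
determined by the sequence of domains {Ω_{k+1}, Ω_k, …}, and the corresponding sequence of fields {V_{k+1}|_{Γ_{k+1}},
V_k|_{Γ_k}, …}."* — SKELETON row **B14.Eq3.10–3.11** (the sentence was typed as the `Prop` `B14.Sect3Decomp.Claim310` by
`B14Sect3Decomp`, p244000, "a claim by reference to the variational results of [15], NOT proved"; it is PROVED here).

THE ARGUMENT (the printed sentence unpacked; [15] = Bałaban, CMP 102 (1985) 277–309, Theorem 1).  `U_k = U_k(V_k)` is the
minimal configuration of the action `A` on the fibre `{U : M^k(U) = V_k}` (within the admissible class — the older constraints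
`M^j(U) = V_j` on `Γ_j`, `j < k`, regularity, gauge conditions — all FIXED data in (3.10)); `U_{k+1}` is the minimal
configuration of `A` on the admissible `U` whose `k`-fold average satisfies the constraint of (3.10), i.e. `M^{k+1}(U) = V_{k+1}`
on `Γ_{k+1}` and the block axial gauge of `M^k(U)` on `B(y)`, `y ∈ Γ_{k+1}` (`iter_succ_apply`: `M(M^k U) = M^{k+1} U`).  Then
for every `V_k` in the constraint set, `A(U_k(M^k U_{k+1})) ≤ A(U_{k+1}) ≤ A(U_k(V_k))` — the first inequality because
`U_{k+1}` lies on the fibre over `M^k(U_{k+1})`, the second because `U_k(V_k)` is admissible with feasible `k`-average — which is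
`Claim310` for the functional `F = A ∘ U_k` (`claim310_of_twoStage`).  If `U_{k+1}` is the UNIQUE such minimizer ([15] Thm 1:
"exactly one critical point"), every minimizer of (3.10) equals `M^k(U_{k+1})` (`isV310_unique_of_twoStage`), and the minimum
VALUE of (3.10) is `A(U_{k+1})` (`isV310_value_eq`).  MODEL INSTANCE on the tree's own background-field carrier
`Setup.Background` (whole-lattice constraint `Γ_{k+1} = T^{(k+1)}`, no block axial gauge, `A` = `wilsonAction4`,
`U_k = bg.U k`): `claim310_background`.  The two variational inputs are exactly the printed references to [15]; nothing of
[15] is asserted here (they are hypotheses / the `Background` datum).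

Mega-formalization `lit-balaban`, unit `lit-balaban-r11` gen 4 (B14 fold owner; upgrade of the NOT-proved clause of row
B14.Eq3.10–3.11), HOME `run/shared/lean/pub/lit-balaban/`.

## References
* [Balaban1988Convergent] T. Bałaban, Commun. Math. Phys. 119 (1988) 243–285, (3.10) and the sentence after it, p. 266.
* [Balaban1985Variational] T. Bałaban, Commun. Math. Phys. 102 (1985) 277–309, Theorem 1 p. 279 (the cited [15]).
-/

noncomputable section

namespace Literature.MathematicalPhysics.QuantumFieldTheory.Balaban1983to89.B14.Claim310TwoStage

open Literature.MathematicalPhysics.QuantumFieldTheory.Balaban1983to89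
open Literature.MathematicalPhysics.QuantumFieldTheory.Balaban1983to89.B14.Sect3Decomp

variable {P : Params} {G : Type*} [GaugeGroup G] {k : ℕ}

/-! ## §1. The `k+1`-level reading of the (3.10) constraint -/

/-- `M(M^k(U)) = M^{k+1}(U)` (`Setup.Averaging.iter`, by definition): the one-step average of the `k`-fold average is the
`k+1`-fold average — the identity behind *"U_{k+1} is determined by the sequence of domains {Ω_{k+1}, Ω_k, …}"*: the (3.10)
constraint `V̄_k = V_{k+1}` on `V_k = M^k(U)` is the level-`k+1` constraint `M^{k+1}(U) = V_{k+1}`. [cite: Balaban1988Convergent, (3.10) p.266] -/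
theorem iter_succ_apply (av : ∀ j, Averaging P j G) (U : GaugeField P 0 G) :
    Averaging.iter av (k+1) U = (av k).avg (Averaging.iter av k U) := rfl

/-- The fine configurations whose `k`-fold average satisfies the constraint of (3.10): `M^{k+1}(U) = V_{k+1}` on the bonds
`Γb` of `Γ_{k+1}` and the block axial gauge of `M^k(U)` on the blocks of the sites `Γs` of `Γ_{k+1}` — the constraint surface
on which *"the minimal configuration U_{k+1}"* of p. 266 minimizes. [cite: Balaban1988Convergent, (3.10) p.266] -/
def fineConstraint310 (av : ∀ j, Averaging P j G) (cd : ContourData P k G) (Γb : Set (PBond P (k+1)))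
    (Γs : Set (Site P (k+1))) (Vk1 : GaugeField P (k+1) G) : Set (GaugeField P 0 G) :=
  {U | (∀ c ∈ Γb, Averaging.iter av (k+1) U c = Vk1 c) ∧
    (∀ y ∈ Γs, ∀ x : Site P k, blockOf x = y → x ≠ emb y → cd.holTo (Averaging.iter av k U) y x = 1)}

/-- `U ∈ fineConstraint310 ↔ M^k(U) ∈ constraint310`: the level-`k+1` constraint surface is the union of the fibres
`{U : M^k(U) = V_k}` over the (3.10) constraint set. [cite: Balaban1988Convergent, (3.10) p.266] -/
theorem mem_fineConstraint310_iff (av : ∀ j, Averaging P j G) (cd : ContourData P k G) (Γb : Set (PBond P (k+1)))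
    (Γs : Set (Site P (k+1))) (Vk1 : GaugeField P (k+1) G) (U : GaugeField P 0 G) :
    U ∈ fineConstraint310 av cd Γb Γs Vk1 ↔ Averaging.iter av k U ∈ constraint310 (av k) cd Γb Γs Vk1 :=
  Iff.rfl

/-! ## §2. Two-stage constrained minimization (abstract form) -/

section Abstract

variable {X Y : Type*}

/-- **Two-stage minimization, abstract form.**  `π : X → Y`, `A : X → ℝ`, an admissible class `feas ⊆ X`, a constraint set
`C ⊆ Y`; `s : Y → X` a fibre section that is admissible and minimizes `A` on each admissible fibre over `C`
(`π (s y) = y`, `A (s y) ≤ A x` for admissible `x` with `π x = y`); `x⋆` admissible with `π x⋆ ∈ C` minimizing `A` over the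
admissible `x` with `π x ∈ C`.  Then `π x⋆` minimizes `y ↦ A (s y)` on `C`.  (The mechanism of *"This minimum is given by
V^{(k)} = M^k(U_{k+1})"*, p. 266, with `π = M^k`, `s = U_k(·)`, `x⋆ = U_{k+1}`.) [cite: Balaban1988Convergent, (3.10) p.266] -/
theorem twoStage_argmin (π : X → Y) (A : X → ℝ) (feas : Set X) (C : Set Y) (s : Y → X)
    (hsec : ∀ y ∈ C, π (s y) = y) (hadm : ∀ y ∈ C, s y ∈ feas)
    (hfib : ∀ y ∈ C, ∀ x ∈ feas, π x = y → A (s y) ≤ A x)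
    {xs : X} (hxs : xs ∈ feas) (hxsC : π xs ∈ C)
    (hmin : ∀ x ∈ feas, π x ∈ C → A xs ≤ A x) :
    ∀ y ∈ C, A (s (π xs)) ≤ A (s y) := by
  intro y hy
  calc A (s (π xs)) ≤ A xs := hfib (π xs) hxsC xs hxs rfl
    _ ≤ A (s y) := hmin (s y) (hadm y hy) (by rw [hsec y hy]; exact hy)

/-- The minimum VALUE of the two-stage problem is `A x⋆`: `A (s (π x⋆)) = A x⋆`. [cite: Balaban1988Convergent, (3.10) p.266] -/
theorem twoStage_value (π : X → Y) (A : X → ℝ) (feas : Set X) (C : Set Y) (s : Y → X)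
    (hsec : ∀ y ∈ C, π (s y) = y) (hadm : ∀ y ∈ C, s y ∈ feas)
    (hfib : ∀ y ∈ C, ∀ x ∈ feas, π x = y → A (s y) ≤ A x)
    {xs : X} (hxs : xs ∈ feas) (hxsC : π xs ∈ C)
    (hmin : ∀ x ∈ feas, π x ∈ C → A xs ≤ A x) :
    A (s (π xs)) = A xs :=
  le_antisymm (hfib (π xs) hxsC xs hxs rfl)
    (hmin (s (π xs)) (hadm _ hxsC) (by rw [hsec _ hxsC]; exact hxsC))

/-- **Uniqueness transfer.**  If `x⋆` is the UNIQUE admissible minimizer with `π x⋆ ∈ C` ([15] Thm 1: *"exactly one critical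
point"*), then every minimizer `y₀ ∈ C` of `y ↦ A (s y)` on `C` is `π x⋆`. [cite: Balaban1988Convergent, (3.10) p.266] -/
theorem twoStage_unique (π : X → Y) (A : X → ℝ) (feas : Set X) (C : Set Y) (s : Y → X)
    (hsec : ∀ y ∈ C, π (s y) = y) (hadm : ∀ y ∈ C, s y ∈ feas)
    (hfib : ∀ y ∈ C, ∀ x ∈ feas, π x = y → A (s y) ≤ A x)
    {xs : X} (hxs : xs ∈ feas) (hxsC : π xs ∈ C)
    (huniq : ∀ x ∈ feas, π x ∈ C → A x ≤ A xs → x = xs)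
    {y₀ : Y} (hy₀ : y₀ ∈ C) (hy₀min : ∀ y ∈ C, A (s y₀) ≤ A (s y)) :
    y₀ = π xs := by
  have h1 : A (s y₀) ≤ A xs :=
    (hy₀min (π xs) hxsC).trans (hfib (π xs) hxsC xs hxs rfl)
  have h2 : s y₀ = xs := huniq (s y₀) (hadm y₀ hy₀) (by rw [hsec y₀ hy₀]; exact hy₀) h1
  rw [← hsec y₀ hy₀, h2]

end Abstract

/-! ## §3. The printed sentence: `Claim310` PROVED from the two variational inputs -/

/-- **p. 266, the sentence after (3.10), PROVED**: *"This minimum is given by V^{(k)} = M^k(U_{k+1})"* — for the functional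
`F = A ∘ U_k` of (3.10) (`V_k ↦ A(U_k(V_k))`), `M^k(U_{k+1})` is a minimizer over the (3.10) constraint set
(`B14.Sect3Decomp.Claim310`), GIVEN the two variational inputs the sentence refers to [15] for: (i) for every `V_k` in the
constraint set, `U_k(V_k)` is an admissible configuration on the fibre `M^k(U) = V_k` minimizing `A` among the admissible
configurations of that fibre (`hsec`, `hadm`, `hfib`); (ii) `U_{k+1}` is admissible, its `k`-fold average satisfies the (3.10)
constraint (equivalently `U_{k+1} ∈ fineConstraint310`, `mem_fineConstraint310_iff`), and it minimizes `A` among all such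
configurations (`hmin`).  `feas` = the admissible class (older constraints `M^j(U) = V_j` on `Γ_j`, regularity, gauge
conditions — fixed data). [cite: Balaban1988Convergent, (3.10) p.266] -/
theorem claim310_of_twoStage (A : GaugeField P 0 G → ℝ) (Uk : GaugeField P k G → GaugeField P 0 G)
    (feas : Set (GaugeField P 0 G)) (av : ∀ j, Averaging P j G) (cd : ContourData P k G)
    (Γb : Set (PBond P (k+1))) (Γs : Set (Site P (k+1))) (Vk1 : GaugeField P (k+1) G)
    (hsec : ∀ W ∈ constraint310 (av k) cd Γb Γs Vk1, Averaging.iter av k (Uk W) = W)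
    (hadm : ∀ W ∈ constraint310 (av k) cd Γb Γs Vk1, Uk W ∈ feas)
    (hfib : ∀ W ∈ constraint310 (av k) cd Γb Γs Vk1, ∀ U ∈ feas, Averaging.iter av k U = W → A (Uk W) ≤ A U)
    {Uk1 : GaugeField P 0 G} (hUk1 : Uk1 ∈ feas)
    (hUk1C : Averaging.iter av k Uk1 ∈ constraint310 (av k) cd Γb Γs Vk1)
    (hmin : ∀ U ∈ feas, Averaging.iter av k U ∈ constraint310 (av k) cd Γb Γs Vk1 → A Uk1 ≤ A U) :
    Claim310 (A ∘ Uk) av cd Γb Γs Vk1 Uk1 :=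
  ⟨hUk1C, twoStage_argmin (Averaging.iter av k) A feas _ Uk hsec hadm hfib hUk1 hUk1C hmin⟩

/-- The same with input (ii) phrased on the level-`k+1` constraint surface `fineConstraint310` (`M^{k+1}(U) = V_{k+1}` on
`Γ_{k+1}`, block axial gauge of `M^k(U)`), as p. 266 reads it: *"U_{k+1} is determined by the sequence of domains
{Ω_{k+1}, Ω_k, …}, and the corresponding sequence of fields {V_{k+1}|_{Γ_{k+1}}, V_k|_{Γ_k}, …}"*. [cite: Balaban1988Convergent, (3.10) p.266] -/
theorem claim310_of_fineConstraint (A : GaugeField P 0 G → ℝ) (Uk : GaugeField P k G → GaugeField P 0 G)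
    (feas : Set (GaugeField P 0 G)) (av : ∀ j, Averaging P j G) (cd : ContourData P k G)
    (Γb : Set (PBond P (k+1))) (Γs : Set (Site P (k+1))) (Vk1 : GaugeField P (k+1) G)
    (hsec : ∀ W ∈ constraint310 (av k) cd Γb Γs Vk1, Averaging.iter av k (Uk W) = W)
    (hadm : ∀ W ∈ constraint310 (av k) cd Γb Γs Vk1, Uk W ∈ feas)
    (hfib : ∀ W ∈ constraint310 (av k) cd Γb Γs Vk1, ∀ U ∈ feas, Averaging.iter av k U = W → A (Uk W) ≤ A U)
    {Uk1 : GaugeField P 0 G} (hUk1 : Uk1 ∈ feas ∩ fineConstraint310 av cd Γb Γs Vk1)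
    (hmin : ∀ U ∈ feas ∩ fineConstraint310 av cd Γb Γs Vk1, A Uk1 ≤ A U) :
    Claim310 (A ∘ Uk) av cd Γb Γs Vk1 Uk1 :=
  claim310_of_twoStage A Uk feas av cd Γb Γs Vk1 hsec hadm hfib hUk1.1
    ((mem_fineConstraint310_iff av cd Γb Γs Vk1 Uk1).1 hUk1.2)
    (fun U hU hC => hmin U ⟨hU, (mem_fineConstraint310_iff av cd Γb Γs Vk1 U).2 hC⟩)

/-- **The minimum value of (3.10)** is `A(U_{k+1})`: `A(U_k(M^k(U_{k+1}))) = A(U_{k+1})` (same hypotheses).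
[cite: Balaban1988Convergent, (3.10) p.266] -/
theorem isV310_value_eq (A : GaugeField P 0 G → ℝ) (Uk : GaugeField P k G → GaugeField P 0 G)
    (feas : Set (GaugeField P 0 G)) (av : ∀ j, Averaging P j G) (cd : ContourData P k G)
    (Γb : Set (PBond P (k+1))) (Γs : Set (Site P (k+1))) (Vk1 : GaugeField P (k+1) G)
    (hsec : ∀ W ∈ constraint310 (av k) cd Γb Γs Vk1, Averaging.iter av k (Uk W) = W)
    (hadm : ∀ W ∈ constraint310 (av k) cd Γb Γs Vk1, Uk W ∈ feas)
    (hfib : ∀ W ∈ constraint310 (av k) cd Γb Γs Vk1, ∀ U ∈ feas, Averaging.iter av k U = W → A (Uk W) ≤ A U)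
    {Uk1 : GaugeField P 0 G} (hUk1 : Uk1 ∈ feas)
    (hUk1C : Averaging.iter av k Uk1 ∈ constraint310 (av k) cd Γb Γs Vk1)
    (hmin : ∀ U ∈ feas, Averaging.iter av k U ∈ constraint310 (av k) cd Γb Γs Vk1 → A Uk1 ≤ A U) :
    (A ∘ Uk) (Averaging.iter av k Uk1) = A Uk1 :=
  twoStage_value (Averaging.iter av k) A feas _ Uk hsec hadm hfib hUk1 hUk1C hmin

/-- **Uniqueness of the (3.10) minimum** (*"the minimum"*, definite article): if `U_{k+1}` is the UNIQUE admissible minimizer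
on the level-`k+1` constraint surface ([15] Thm 1, *"there exists exactly one critical point"*, quoted p. 248), then every
minimizer of (3.10) in the sense of `B14.Sect3Decomp.IsV310` IS `M^k(U_{k+1})`. [cite: Balaban1988Convergent, (3.10) p.266] -/
theorem isV310_unique_of_twoStage (A : GaugeField P 0 G → ℝ) (Uk : GaugeField P k G → GaugeField P 0 G)
    (feas : Set (GaugeField P 0 G)) (av : ∀ j, Averaging P j G) (cd : ContourData P k G)
    (Γb : Set (PBond P (k+1))) (Γs : Set (Site P (k+1))) (Vk1 : GaugeField P (k+1) G)
    (hsec : ∀ W ∈ constraint310 (av k) cd Γb Γs Vk1, Averaging.iter av k (Uk W) = W)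
    (hadm : ∀ W ∈ constraint310 (av k) cd Γb Γs Vk1, Uk W ∈ feas)
    (hfib : ∀ W ∈ constraint310 (av k) cd Γb Γs Vk1, ∀ U ∈ feas, Averaging.iter av k U = W → A (Uk W) ≤ A U)
    {Uk1 : GaugeField P 0 G} (hUk1 : Uk1 ∈ feas)
    (hUk1C : Averaging.iter av k Uk1 ∈ constraint310 (av k) cd Γb Γs Vk1)
    (huniq : ∀ U ∈ feas, Averaging.iter av k U ∈ constraint310 (av k) cd Γb Γs Vk1 → A U ≤ A Uk1 → U = Uk1)
    {W₀ : GaugeField P k G} (hW₀ : IsV310 (A ∘ Uk) (av k) cd Γb Γs Vk1 W₀) :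
    W₀ = Averaging.iter av k Uk1 :=
  twoStage_unique (Averaging.iter av k) A feas _ Uk hsec hadm hfib hUk1 hUk1C huniq hW₀.1 hW₀.2

/-! ## §4. Model instance: the tree's background-field carrier `Setup.Background` (whole-lattice constraint) -/

/-- With the whole-lattice constraint (`Γb` = all bonds of `T^{(k+1)}`) and no block axial gauge (`Γs = ∅`) the (3.10)
constraint set is `{V_k : M(V_k) = V_{k+1}}`. [cite: Balaban1988Convergent, (3.10) p.266] -/
theorem mem_constraint310_univ_iff (av : Averaging P k G) (cd : ContourData P k G) (Vk1 : GaugeField P (k+1) G)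
    (W : GaugeField P k G) :
    W ∈ constraint310 av cd Set.univ ∅ Vk1 ↔ av.avg W = Vk1 := by
  unfold constraint310
  simp only [Set.mem_univ, forall_const, Set.mem_empty_iff_false, false_imp_iff, and_true,
    Set.mem_setOf_eq]
  exact ⟨fun h => funext h, fun h c => by rw [h]⟩

/-- **Model instance of the sentence on `Setup.Background`.**  `bg : Background P G av` packages the background-field maps
`V ↦ U_j(V) = bg.U j V` with their defining property `Setup.IsBackground` (minimality of the Wilson action on the fibre
`{U ∈ reg : M^j(U) = V}` for `V ∈ bg.dom j` — the [15] Thm 1 content as DATA).  In the whole-lattice case `Γ_{k+1} = T^{(k+1)}`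
(no block axial gauge), if `V_{k+1} ∈ bg.dom (k+1)` and every `V_k` with `M(V_k) = V_{k+1}` lies in `bg.dom k`, then
*"This minimum is given by V^{(k)} = M^k(U_{k+1})"* holds for `F = wilsonAction4 ∘ U_k` and `U_{k+1} = bg.U (k+1) V_{k+1}`.
[cite: Balaban1988Convergent, (3.10) p.266] -/
theorem claim310_background {av : ∀ j, Averaging P j G} (bg : Background P G av) (cd : ContourData P k G)
    (Vk1 : GaugeField P (k+1) G) (hdom1 : Vk1 ∈ bg.dom (k+1))
    (hdom : ∀ W : GaugeField P k G, (av k).avg W = Vk1 → W ∈ bg.dom k) :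
    Claim310 (wilsonAction4 ∘ bg.U k) av cd Set.univ ∅ Vk1 (bg.U (k+1) Vk1) := by
  have hB1 := bg.isBackground (k+1) Vk1 hdom1
  refine claim310_of_twoStage wilsonAction4 (bg.U k) bg.reg av cd Set.univ ∅ Vk1 ?_ ?_ ?_ hB1.2.1 ?_ ?_
  · intro W hW
    exact (bg.isBackground k W (hdom W ((mem_constraint310_univ_iff _ cd _ _).1 hW))).1
  · intro W hW
    exact (bg.isBackground k W (hdom W ((mem_constraint310_univ_iff _ cd _ _).1 hW))).2.1
  · intro W hW U hU hπ
    exact (bg.isBackground k W (hdom W ((mem_constraint310_univ_iff _ cd _ _).1 hW))).2.2 U hU hπ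
  · exact (mem_constraint310_univ_iff _ cd _ _).2 hB1.1
  · intro U hU hC
    exact hB1.2.2 U hU ((mem_constraint310_univ_iff _ cd _ _).1 hC)

/-- In the model instance the (3.10) minimum is, moreover, UNIQUE as soon as `U_{k+1}(V_{k+1})` is the unique minimizer of its
own variational problem (the uniqueness half of [15] Thm 1, an explicit hypothesis — `Setup.IsBackground` records only
minimality). [cite: Balaban1988Convergent, (3.10) p.266] -/
theorem isV310_unique_background {av : ∀ j, Averaging P j G} (bg : Background P G av) (cd : ContourData P k G)
    (Vk1 : GaugeField P (k+1) G) (hdom1 : Vk1 ∈ bg.dom (k+1))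
    (hdom : ∀ W : GaugeField P k G, (av k).avg W = Vk1 → W ∈ bg.dom k)
    (huniq : ∀ U ∈ bg.reg, Averaging.iter av (k+1) U = Vk1 →
      wilsonAction4 U ≤ wilsonAction4 (bg.U (k+1) Vk1) → U = bg.U (k+1) Vk1)
    {W₀ : GaugeField P k G} (hW₀ : IsV310 (wilsonAction4 ∘ bg.U k) (av k) cd Set.univ ∅ Vk1 W₀) :
    W₀ = Averaging.iter av k (bg.U (k+1) Vk1) := by
  have hB1 := bg.isBackground (k+1) Vk1 hdom1
  refine isV310_unique_of_twoStage wilsonAction4 (bg.U k) bg.reg av cd Set.univ ∅ Vk1 ?_ ?_ ?_ hB1.2.1 ?_ ?_ hW₀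
  · intro W hW
    exact (bg.isBackground k W (hdom W ((mem_constraint310_univ_iff _ cd _ _).1 hW))).1
  · intro W hW
    exact (bg.isBackground k W (hdom W ((mem_constraint310_univ_iff _ cd _ _).1 hW))).2.1
  · intro W hW U hU hπ
    exact (bg.isBackground k W (hdom W ((mem_constraint310_univ_iff _ cd _ _).1 hW))).2.2 U hU hπ
  · exact (mem_constraint310_univ_iff _ cd _ _).2 hB1.1
  · intro U hU hC hle
    exact huniq U hU ((mem_constraint310_univ_iff _ cd _ _).1 hC) hle

end Literature.MathematicalPhysics.QuantumFieldTheory.Balaban1983to89.B14.Claim310TwoStage
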